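import Summits.CriticalPhenomena.PercolationContinuityZ3.Theorems.SahiMasterFamily

/-!
# The comb (tensor-Bernstein) hierarchy for Sahi's `E_k`, I: comb positivity as a certificate class

Support file of the one-cut programme (crux `NoHeavyLowerTail`, stmt-CriticalPhenomena-4575; cell `prim-masterthm`,
seat P3 "polarisation / Bernstein hierarchy", `run/shared/lean/prim/prim-masterthm/prim-masterthm-p3/HIERARCHY.md`).

A function `F : [0,1]^ι → ℝ` of the coordinate probabilities is **comb-positive at multidegree `c : ι → ℕ`**
(`CombPos c F`) if it is a nonnegative combination of the (unnormalised) tensor-Bernstein basis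
`b^c_j(p) = ∏_e p_e^{j_e} (1 − p_e)^{c_e − j_e}`, `j ≤ c`.  For `F = p ↦ E_k(μ_p; 1_{U_1},…,1_{U_k})` and `c ≡ k`
this is the coefficientwise statement (M⁺-k) of `run/shared/lean/prim/MASTER-FAMILY.md` §MASTER (the representation
in the degree-`k` basis is unique, so "some nonnegative representation" = "the tensor-Bernstein coefficients — the
`k`-copy fibre sums — are `≥ 0`"; uniqueness is not needed below and not proved here).

This file is the algebra of the certificate class, used by the companion files (`…SahiCombMasterFamily`: (M⁺-k) typed,
(M⁺-k) ⇒ (M-k), (M⁺-2) proved; `…SahiCombStrata`: the all-`k` strata of the `k → k+1` step at the comb level):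
* `CombPos.nonneg` — comb-positive functions are `≥ 0` on the closed cube ((M⁺) ⇒ (M));
* `CombPos.eq_zero_of_interior` — a comb-positive function vanishing at ONE interior point vanishes identically
  (density-free zero sets, (M⁺-k) ⇒ (EQ⁰-k));
* closure under `+`, nonnegative scalars, finite sums, PRODUCTS (multidegrees add: `CombPos.mul`), degree elevation
  (`CombPos.mono`), and restriction of the multidegree to `0` at a coordinate the function ignores (`CombPos.of_ignores`);
* base cases: constants `≥ 0`, the one-coordinate basis functions `p_e^x(1−p_e)^{n−x}`, and every moment
  `p ↦ E_{μ_p}[h]` of a nonnegative function `h` at multidegree `1` (`combPos_ex`) — in particular probabilities of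
  arbitrary events and "defect" moments `μ_p(A ∖ B)`.
Everything here is proved; axioms standard. [this work]
-/

noncomputable section

open scoped Classical

namespace Summit.CriticalPhenomena.PercolationContinuityZ3.Theorems

open Finset Function
open Literature.Combinatorics.Sahi2008
open Literature.Probability.Percolation.BHK2006 (weight)

namespace SahiComb

variable {ι : Type*} [Fintype ι]

/-! ### The tensor-Bernstein basis and the certificate class -/

/-- The unnormalised tensor-Bernstein basis function of multidegree `c` at the profile `j`:
`b^c_j(p) = ∏_e p_e^{j_e}(1 − p_e)^{c_e − j_e}`. [folklore] -/
def bern (c j : ι → ℕ) (p : ι → unitInterval) : ℝ :=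
  ∏ e, ((p e : ℝ) ^ (j e) * (1 - (p e : ℝ)) ^ (c e - j e))

/-- The box of profiles `j ≤ c` (coordinatewise). [folklore] -/
def box (c : ι → ℕ) : Finset (ι → ℕ) := Fintype.piFinset fun e => Finset.range (c e + 1)

/-- **Comb positivity at multidegree `c`**: `F` is a nonnegative combination of the degree-`c` tensor-Bernstein basis on
the closed cube, `F(p) = Σ_{j ≤ c} N_j · ∏_e p_e^{j_e}(1−p_e)^{c_e−j_e}` with all `N_j ≥ 0` (equivalently — by uniqueness of
Bernstein coefficients, not used here — its tensor-Bernstein coefficients are `≥ 0`). [this work] -/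
def CombPos (c : ι → ℕ) (F : (ι → unitInterval) → ℝ) : Prop :=
  ∃ N : (ι → ℕ) → ℝ, (∀ j, 0 ≤ N j) ∧ ∀ p, F p = ∑ j ∈ box c, N j * bern c j p

/-- Membership in the box is `j ≤ c` coordinatewise. [folklore] -/
theorem mem_box {c j : ι → ℕ} : j ∈ box c ↔ ∀ e, j e ≤ c e := by
  simp only [box, Fintype.mem_piFinset, Finset.mem_range, Nat.lt_succ_iff]

/-- Basis functions are nonnegative on the closed cube. [folklore] -/
theorem bern_nonneg (c j : ι → ℕ) (p : ι → unitInterval) : 0 ≤ bern c j p :=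
  prod_nonneg fun e _ => mul_nonneg (pow_nonneg (p e).2.1 _) (pow_nonneg (sub_nonneg.2 (p e).2.2) _)

/-- Basis functions of profiles in the box are positive in the open cube. [folklore] -/
theorem bern_pos (c j : ι → ℕ) {p : ι → unitInterval} (hp : ∀ e, (p e : ℝ) ∈ Set.Ioo (0 : ℝ) 1) :
    0 < bern c j p :=
  prod_pos fun e _ => mul_pos (pow_pos (hp e).1 _) (pow_pos (sub_pos.2 (hp e).2) _)

/-- The product of basis functions is the basis function of the summed multidegree and profile. [folklore] -/
theorem bern_mul_bern {c d a b : ι → ℕ} (ha : a ∈ box c) (hb : b ∈ box d) (p : ι → unitInterval) :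
    bern c a p * bern d b p = bern (c + d) (a + b) p := by
  unfold bern
  rw [← prod_mul_distrib]
  refine prod_congr rfl fun e _ => ?_
  have h1 : a e ≤ c e := mem_box.1 ha e
  have h2 : b e ≤ d e := mem_box.1 hb e
  have h3 : (c + d) e - (a + b) e = (c e - a e) + (d e - b e) := by
    simp only [Pi.add_apply]; omega
  rw [h3, Pi.add_apply, pow_add, pow_add]
  ring

/-! ### Consequences of a certificate -/

namespace CombPos

variable {c d : ι → ℕ} {F G : (ι → unitInterval) → ℝ}

/-- **(M⁺) ⇒ (M)**: a comb-positive function is nonnegative on the closed cube. [this work] -/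
theorem nonneg (h : CombPos c F) (p : ι → unitInterval) : 0 ≤ F p := by
  obtain ⟨N, hN, hF⟩ := h
  rw [hF p]
  exact sum_nonneg fun j _ => mul_nonneg (hN j) (bern_nonneg c j p)

/-- **Density-free zeros**: a comb-positive function that vanishes at one point of the OPEN cube vanishes on the whole
closed cube (every basis function is positive inside, so all coefficients vanish). [this work] -/
theorem eq_zero_of_interior (h : CombPos c F) {q : ι → unitInterval} (hq : ∀ e, (q e : ℝ) ∈ Set.Ioo (0 : ℝ) 1)
    (h0 : F q = 0) (p : ι → unitInterval) : F p = 0 := by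
  obtain ⟨N, hN, hF⟩ := h
  have hterm : ∀ j ∈ box c, 0 ≤ N j * bern c j q := fun j _ => mul_nonneg (hN j) (bern_nonneg c j q)
  have hz := (sum_eq_zero_iff_of_nonneg hterm).1 (by rw [← hF q]; exact h0)
  have hN0 : ∀ j ∈ box c, N j = 0 := fun j hj =>
    (mul_eq_zero.1 (hz j hj)).resolve_right (bern_pos c j hq).ne'
  rw [hF p]
  exact sum_eq_zero fun j hj => by rw [hN0 j hj, zero_mul]

/-- Transport along a pointwise identity. [this work] -/
theorem congr (h : CombPos c F) (hFG : ∀ p, G p = F p) : CombPos c G := by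
  obtain ⟨N, hN, hF⟩ := h
  exact ⟨N, hN, fun p => by rw [hFG p, hF p]⟩

/-! ### Closure properties -/

/-- `0` is comb-positive at every multidegree. [this work] -/
theorem zero (c : ι → ℕ) : CombPos c (fun _ => 0) :=
  ⟨fun _ => 0, fun _ => le_rfl, fun p => by simp⟩

/-- Sums. [this work] -/
theorem add (hF : CombPos c F) (hG : CombPos c G) : CombPos c (fun p => F p + G p) := by
  obtain ⟨N, hN, hF⟩ := hF
  obtain ⟨M, hM, hG⟩ := hG
  refine ⟨fun j => N j + M j, fun j => add_nonneg (hN j) (hM j), fun p => ?_⟩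
  dsimp only
  rw [hF p, hG p, ← sum_add_distrib]
  exact sum_congr rfl fun j _ => by ring

/-- Nonnegative scalar multiples. [this work] -/
theorem smul (hF : CombPos c F) {a : ℝ} (ha : 0 ≤ a) : CombPos c (fun p => a * F p) := by
  obtain ⟨N, hN, hF⟩ := hF
  refine ⟨fun j => a * N j, fun j => mul_nonneg ha (hN j), fun p => ?_⟩
  dsimp only
  rw [hF p, mul_sum]
  exact sum_congr rfl fun j _ => by ring

/-- Finite sums. [this work] -/
theorem sum {κ : Type*} (s : Finset κ) {F : κ → (ι → unitInterval) → ℝ} (h : ∀ k ∈ s, CombPos c (F k)) :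
    CombPos c (fun p => ∑ k ∈ s, F k p) := by
  induction s using Finset.induction_on with
  | empty => simpa using zero c
  | insert a s ha ih =>
    have h1 := add (h a (mem_insert_self a s)) (ih fun k hk => h k (mem_insert_of_mem hk))
    refine h1.congr fun p => ?_
    rw [sum_insert ha]

/-- **Products**: multidegrees add. [this work] -/
theorem mul (hF : CombPos c F) (hG : CombPos d G) : CombPos (c + d) (fun p => F p * G p) := by
  obtain ⟨N, hN, hF⟩ := hF
  obtain ⟨M, hM, hG⟩ := hG
  refine ⟨fun j => ∑ a ∈ box c, ∑ b ∈ box d, if a + b = j then N a * M b else 0,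
    fun j => sum_nonneg fun a _ => sum_nonneg fun b _ => ?_, fun p => ?_⟩
  · split_ifs
    · exact mul_nonneg (hN a) (hM b)
    · exact le_rfl
  dsimp only
  rw [hF p, hG p, sum_mul_sum]
  -- right-hand side: exchange the sums and collapse the indicator
  have hrhs : ∑ j ∈ box (c + d), (∑ a ∈ box c, ∑ b ∈ box d, if a + b = j then N a * M b else 0) * bern (c + d) j p
      = ∑ a ∈ box c, ∑ b ∈ box d, N a * M b * bern (c + d) (a + b) p := by
    have step1 : ∑ j ∈ box (c + d), (∑ a ∈ box c, ∑ b ∈ box d, if a + b = j then N a * M b else 0) * bern (c + d) j p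
        = ∑ j ∈ box (c + d), ∑ a ∈ box c, ∑ b ∈ box d,
            (if a + b = j then N a * M b * bern (c + d) j p else 0) := by
      refine sum_congr rfl fun j _ => ?_
      rw [sum_mul]
      refine sum_congr rfl fun a _ => ?_
      rw [sum_mul]
      refine sum_congr rfl fun b _ => ?_
      split_ifs <;> simp
    rw [step1, sum_comm]
    refine sum_congr rfl fun a ha => ?_
    rw [sum_comm]
    refine sum_congr rfl fun b hb => ?_
    have hab : a + b ∈ box (c + d) := by
      rw [mem_box] at ha hb ⊢
      intro e
      simp only [Pi.add_apply]
      exact Nat.add_le_add (ha e) (hb e)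
    rw [sum_ite_eq (box (c + d)) (a + b) (fun j => N a * M b * bern (c + d) j p), if_pos hab]
  rw [hrhs]
  refine sum_congr rfl fun a ha => sum_congr rfl fun b hb => ?_
  rw [← bern_mul_bern ha hb]
  ring

end CombPos

/-! ### Base certificates -/

/-- The partition of unity: the constant `1` is comb-positive at every multidegree
(`1 = ∏_e (p_e + (1 − p_e))^{c_e}`, coefficients `∏_e C(c_e, j_e)`). [folklore] -/
theorem combPos_one (c : ι → ℕ) : CombPos c (fun _ => (1 : ℝ)) := by
  refine ⟨fun j => ∏ e, ((c e).choose (j e) : ℝ), fun j => prod_nonneg fun e _ => Nat.cast_nonneg _, fun p => ?_⟩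
  have h1 : (1 : ℝ) = ∏ e : ι, ∑ x ∈ Finset.range (c e + 1),
      (p e : ℝ) ^ x * (1 - (p e : ℝ)) ^ (c e - x) * ((c e).choose x : ℝ) := by
    rw [eq_comm]
    refine prod_eq_one fun e _ => ?_
    rw [← add_pow]
    simp
  rw [h1, prod_univ_sum]
  refine sum_congr rfl fun j _ => ?_
  unfold bern
  rw [mul_comm, ← prod_mul_distrib]

/-- Nonnegative constants. [folklore] -/
theorem combPos_const (c : ι → ℕ) {a : ℝ} (ha : 0 ≤ a) : CombPos c (fun _ => a) :=
  ((combPos_one c).smul ha).congr fun _ => by rw [mul_one]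

namespace CombPos

variable {c d : ι → ℕ} {F G : (ι → unitInterval) → ℝ}

/-- **Degree elevation**: comb positivity is inherited by every larger multidegree. [this work] -/
theorem mono (h : CombPos c F) (hcd : c ≤ d) : CombPos d F := by
  have h1 := h.mul (combPos_one (d - c))
  have hdeg : c + (d - c) = d := funext fun e => by
    simp only [Pi.add_apply, Pi.sub_apply]; exact Nat.add_sub_cancel' (hcd e)
  rw [hdeg] at h1
  exact h1.congr fun p => by rw [mul_one]

/-- Products, with the target multidegree given up to equality. [this work] -/
theorem mul_of_eq (hF : CombPos c F) (hG : CombPos d G) {m : ι → ℕ} (hm : c + d = m) :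
    CombPos m (fun p => F p * G p) := hm ▸ hF.mul hG

/-- Products, with the target multidegree given up to `≤`. [this work] -/
theorem mul_of_le (hF : CombPos c F) (hG : CombPos d G) {m : ι → ℕ} (hm : c + d ≤ m) :
    CombPos m (fun p => F p * G p) := (hF.mul hG).mono hm

/-- **Restriction at an ignored coordinate**: if `F` does not depend on `p_e`, a certificate of multidegree `c` yields one
of multidegree `c` with `c_e` replaced by `0` (evaluate the representation at `p_e = 0`). [this work] -/
theorem of_ignores (h : CombPos c F) (e : ι) (hF : ∀ p s, F (update p e s) = F p) :
    CombPos (update c e 0) F := by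
  obtain ⟨N, hN, hrep⟩ := h
  refine ⟨N, hN, fun p => ?_⟩
  rw [← hF p 0, hrep (update p e 0)]
  -- profiles with `j_e ≠ 0` die at `p_e = 0`; the others give the restricted basis functions
  have hsub : box (update c e 0) ⊆ box c := by
    intro j hj
    rw [mem_box] at hj ⊢
    intro e'
    by_cases he : e' = e
    · subst he; have := hj e'; simp only [update_self, nonpos_iff_eq_zero] at this; omega
    · have := hj e'; rwa [update_of_ne he] at this
  rw [← sum_subset hsub]
  · refine sum_congr rfl fun j hj => ?_
    have hje : j e = 0 := by have := mem_box.1 hj e; simpa using this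
    congr 1
    unfold bern
    refine prod_congr rfl fun e' _ => ?_
    by_cases he : e' = e
    · subst he
      simp only [update_self, hje, pow_zero, Nat.sub_zero, one_mul]
      rw [show ((0 : unitInterval) : ℝ) = 0 from rfl, sub_zero, one_pow]
    · rw [update_of_ne he, update_of_ne he]
  · intro j hj hj'
    have hje : j e ≠ 0 := by
      intro h0
      apply hj'
      rw [mem_box] at hj ⊢
      intro e'
      by_cases he : e' = e
      · subst he; rw [update_self, h0]
      · rw [update_of_ne he]; exact hj e'
    have hb : bern c j (update p e 0) = 0 := by
      unfold bern
      refine prod_eq_zero (mem_univ e) ?_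
      simp only [update_self]
      rw [show ((0 : unitInterval) : ℝ) = 0 from rfl, zero_pow hje, zero_mul]
    rw [hb, mul_zero]

end CombPos

/-- The one-coordinate basis function `p_e^x (1 − p_e)^{n − x}` (`x ≤ n`) is comb-positive at the multidegree
`n·δ_e`. [folklore] -/
theorem combPos_single (e : ι) {n x : ℕ} (hx : x ≤ n) :
    CombPos (Pi.single e n) (fun p => (p e : ℝ) ^ x * (1 - (p e : ℝ)) ^ (n - x)) := by
  refine ⟨fun j => if j = Pi.single e x then 1 else 0, fun j => by dsimp only; split_ifs <;> norm_num,
    fun p => ?_⟩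
  have hmem : (Pi.single e x : ι → ℕ) ∈ box (Pi.single e n) := by
    rw [mem_box]; intro e'
    by_cases he : e' = e
    · subst he; simpa using hx
    · simp [he]
  dsimp only
  simp only [ite_mul, one_mul, zero_mul]
  rw [sum_ite_eq' (box (Pi.single e n)) (Pi.single e x) (fun j => bern (Pi.single e n) j p), if_pos hmem]
  unfold bern
  rw [← prod_erase_mul _ _ (mem_univ e)]
  simp only [Pi.single_eq_same]
  rw [prod_eq_one fun e' he' => ?_, one_mul]
  have hne : e' ≠ e := ne_of_mem_erase he'
  simp [hne]

/-- `p_e` is comb-positive at multidegree `δ_e`. [folklore] -/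
theorem combPos_coord (e : ι) : CombPos (Pi.single e 1) (fun p => (p e : ℝ)) :=
  (combPos_single e (le_refl 1)).congr fun p => by simp

/-- `1 − p_e` is comb-positive at multidegree `δ_e`. [folklore] -/
theorem combPos_one_sub_coord (e : ι) : CombPos (Pi.single e 1) (fun p => 1 - (p e : ℝ)) :=
  (combPos_single e (Nat.zero_le 1)).congr fun p => by simp

/-! ### Moments of nonnegative functions under the product weight -/

/-- The product weight of a configuration is the degree-`1` basis function of its indicator profile. [folklore] -/
theorem bernoulliWeight_eq_bern (p : ι → unitInterval) (ω : Set ι) :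
    bernoulliWeight p ω = bern (fun _ => 1) (fun e => if e ∈ ω then 1 else 0) p := by
  unfold bern
  simp only [bernoulliWeight, weight]
  refine prod_congr rfl fun e _ => ?_
  split_ifs <;> simp

/-- **Moments are comb-positive at multidegree `1`**: for every `h ≥ 0` on configurations,
`p ↦ E_{μ_p}[h] = Σ_ω μ_p(ω) h(ω)` is a nonnegative combination of the degree-`1` basis (coefficient of the profile
`1_ω` = `h(ω)`).  Covers probabilities of arbitrary events and all "defect" moments. [this work] -/
theorem combPos_ex {h : Set ι → ℝ} (hh : ∀ ω, 0 ≤ h ω) : CombPos (fun _ => 1) (fun p => ex (bernoulliWeight p) h) := by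
  refine ⟨fun j => h {e | j e = 1}, fun j => hh _, fun p => ?_⟩
  dsimp only
  rw [ex_def]
  -- reindex configurations `ω` by their profiles `e ↦ [e ∈ ω]`
  refine sum_nbij' (fun ω e => if e ∈ ω then 1 else 0) (fun j => {e | j e = 1}) (fun ω _ => ?_) (fun j hj => ?_)
    (fun ω _ => ?_) (fun j hj => ?_) (fun ω _ => ?_)
  · rw [mem_box]; intro e; split_ifs <;> norm_num
  · exact mem_univ _
  · ext e; simp
  · funext e
    have := mem_box.1 hj e
    simp only [Set.mem_setOf_eq]
    split_ifs with h1
    · exact h1.symm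
    · omega
  · rw [bernoulliWeight_eq_bern, mul_comm]
    congr 1
    congr 1
    ext e; simp

/-- Probabilities of events are comb-positive at multidegree `1`. [this work] -/
theorem combPos_ex_ind (A : Set (Set ι)) :
    CombPos (fun _ => 1) (fun p => ex (bernoulliWeight p) (Literature.Probability.Percolation.DecisionTree.ind A)) :=
  combPos_ex fun ω => Literature.Probability.Percolation.DecisionTree.ind_nonneg A ω

/-- `1 − μ_p(A)` is comb-positive at multidegree `1` (it is the probability of the complement). [this work] -/
theorem combPos_one_sub_ex_ind (A : Set (Set ι)) :
    CombPos (fun _ => 1)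
      (fun p => 1 - ex (bernoulliWeight p) (Literature.Probability.Percolation.DecisionTree.ind A)) := by
  have h := combPos_ex (h := fun ω => 1 - Literature.Probability.Percolation.DecisionTree.ind A ω) fun ω => by
    by_cases hω : ω ∈ A
    · rw [Literature.Probability.Percolation.DecisionTree.ind_of_mem hω]; norm_num
    · rw [Literature.Probability.Percolation.DecisionTree.ind_of_not_mem hω]; norm_num
  refine h.congr fun p => ?_
  simp only [ex_def, mul_sub, mul_one, sum_sub_distrib]
  rw [sum_bernoulliWeight p]

/-- `a − μ_p[h]` is comb-positive at multidegree `1` whenever `h ≤ a` pointwise. [this work] -/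
theorem combPos_const_sub_ex {h : Set ι → ℝ} {a : ℝ} (hh : ∀ ω, h ω ≤ a) :
    CombPos (fun _ => 1) (fun p => a - ex (bernoulliWeight p) h) := by
  have h1 := combPos_ex (h := fun ω => a - h ω) fun ω => sub_nonneg.2 (hh ω)
  refine h1.congr fun p => ?_
  simp only [ex_def, mul_sub, sum_sub_distrib, ← sum_mul]
  rw [sum_bernoulliWeight p, one_mul]

end SahiComb

end Summit.CriticalPhenomena.PercolationContinuityZ3.Theorems
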